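import Mathlib.Analysis.MellinTransform
import Mathlib.Analysis.Complex.LocallyUniformLimit
import Mathlib.Analysis.Analytic.Uniqueness
import Mathlib.Analysis.Complex.CauchyIntegral
import Mathlib.Analysis.SpecialFunctions.Integrals.Basic
import Mathlib.MeasureTheory.Integral.DominatedConvergence
import Mathlib.Analysis.Normed.Module.Convex
import Mathlib.Topology.MetricSpace.Thickening
import HarnessLib

/-!
# Bounded generalized power sums have no modes of positive real part

Trunk T-ANT support (complex analysis), used by `Literature/NumberTheory/LFunctions`
(the converse half of Weil's positivity criterion, `WeilCriterionProofs.lean`: a bounded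
"polarised zero sum" `x ↦ ∑_ρ m(ρ) (a_ρ e^{(1/2-ρ)x} + b_ρ e^{(ρ̄-1/2)x})` can have no term with
`Re ρ ≠ 1/2`).

**The lemma.** Let `(λᵢ)_{i ∈ ι}` be a locally finite family of complex numbers with
`Re λᵢ ≤ R`, and `(cᵢ)` complex coefficients with `∑ ‖cᵢ‖ < ∞`. If the generalized power sum
`F(t) = ∑ᵢ cᵢ t^{-λᵢ}` is bounded on `(0, 1]` — equivalently the generalized Dirichlet /
exponential series `F(e^{-x}) = ∑ᵢ cᵢ e^{λᵢ x}` is bounded on `x ≥ 0` — then for every `μ` with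
`Re μ > 0` the coefficients on the fibre `{i | λᵢ = μ}` sum to `0` (`sum_fiber_eq_zero`,
`sum_fiber_eq_zero_of_exp`); if `∑ᵢ cᵢ e^{λᵢ x}` is bounded on all of `ℝ` the same holds for every
`μ` with `Re μ ≠ 0` (`sum_fiber_eq_zero_of_exp_real`). This is the standard Laplace-transform
uniqueness argument (a bounded function has Laplace/Mellin transform holomorphic in the open right
half-plane, so the would-be pole `C_μ/(s - μ)` of `∑ᵢ cᵢ/(s - λᵢ)` must have zero residue);
we know no canonical printed source and tag the statements `[folklore]`.

**Proof.** The truncation `f = F · 1_{(0,1]}` is bounded and measurable, so its Mellin transform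
`𝓜f(s) = ∫₀¹ F(t) t^{s-1} dt` is holomorphic on `Re s > 0`
(`mellin_differentiableAt_of_isBigO_rpow`), and for `Re s > R` dominated convergence gives
`𝓜f(s) = ∑ᵢ cᵢ/(s - λᵢ)` (`hasSum_mellin`, from `hasMellin_cpow_Ioc`). Fix `μ` with `Re μ > 0`.
The compact horizontal segment `K = [μ, R + 2 + i Im μ]` meets only finitely many `λᵢ` (indices
`I₀`); the remaining values form a closed set disjoint from `K`, hence at distance `≥ δ` from it,
and on the convex open neighbourhood `N = K + B(0, δ/2)` (chosen inside `Re s > 0`) the tail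
`G₁(s) = ∑_{i ∉ I₀} cᵢ/(s - λᵢ)` is holomorphic by the Weierstrass `M`-test. With
`q(s) = ∏_{ν ∈ λ(I₀)} (s - ν)`, both `q · (𝓜f - G₁)` and the polynomial
`P(s) = ∑_{i ∈ I₀} cᵢ ∏_{ν ≠ λᵢ} (s - ν)` are holomorphic on `N` and agree on `N ∩ {Re s > R}`,
hence on `N` (identity theorem); at `s = μ` the left side vanishes and
`P(μ) = (∏_{ν ≠ μ} (μ - ν)) · ∑_{λᵢ = μ} cᵢ`, whence the claim.

## Contents

* `BoundedPowerSum.powerSum`, `BoundedPowerSum.mellinInput` — `F` and its truncation.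
* `BoundedPowerSum.differentiableAt_mellin`, `BoundedPowerSum.hasSum_mellin` — the two
  descriptions of `𝓜f`.
* `BoundedPowerSum.sum_fiber_eq_zero` (power form on `(0, 1]`),
  `BoundedPowerSum.sum_fiber_eq_zero_of_exp` (exponential form on `x ≥ 0`),
  `BoundedPowerSum.sum_fiber_eq_zero_of_exp_real` (bounded on `ℝ`, `Re μ ≠ 0`).

Mathlib has the ingredients (Mellin transform and its holomorphy, `hasMellin_cpow_Ioc`,
`differentiableOn_tsum_of_summable_norm`, the identity theorem, thickenings) but no statement of
this kind (searched `Dirichlet series` uniqueness, `Laplace`, `powerSum`).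

## References

* D. V. Widder, *The Laplace Transform*, Princeton (1941), Ch. II (analytic continuation and
  uniqueness of Laplace–Stieltjes transforms) — background for the method only.
-/

noncomputable section

open Complex Filter Set MeasureTheory Metric Asymptotics
open scoped Real Topology

namespace Literature.Analysis.Complex

namespace BoundedPowerSum

variable {ι : Type*} {lam c : ι → ℂ} {R M : ℝ}

/-- The generalized power sum `F(t) = ∑ᵢ cᵢ t^{-λᵢ}` (a `tsum`; junk `0` where the series does not
converge, which does not happen on `(0, 1]` under the standing hypotheses). [folklore] -/
def powerSum (lam c : ι → ℂ) (t : ℝ) : ℂ :=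
  ∑' i, c i * (t : ℂ) ^ (-lam i)

/-- The power sum restricted to `(0, 1]` (extended by `0`), the input of the Mellin transform. [folklore] -/
def mellinInput (lam c : ι → ℂ) : ℝ → ℂ :=
  indicator (Ioc 0 1) (powerSum lam c)

/-- `‖t^{-λ}‖ ≤ t^{-R}` for `t ∈ (0, 1]` and `Re λ ≤ R`. [folklore] -/
theorem norm_cpow_neg_le {t : ℝ} (ht : t ∈ Ioc (0 : ℝ) 1) {l : ℂ} (hl : l.re ≤ R) :
    ‖(t : ℂ) ^ (-l)‖ ≤ t ^ (-R) := by
  rw [Complex.norm_cpow_eq_rpow_re_of_pos ht.1, neg_re]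
  exact Real.rpow_le_rpow_of_exponent_ge ht.1 ht.2 (neg_le_neg hl)

/-- Termwise bound `‖cᵢ t^{-λᵢ}‖ ≤ ‖cᵢ‖ t^{-R}` on `(0, 1]`. [folklore] -/
theorem norm_term_le (hR : ∀ i, (lam i).re ≤ R) {t : ℝ} (ht : t ∈ Ioc (0 : ℝ) 1) (i : ι) :
    ‖c i * (t : ℂ) ^ (-lam i)‖ ≤ ‖c i‖ * t ^ (-R) := by
  rw [norm_mul]
  exact mul_le_mul_of_nonneg_left (norm_cpow_neg_le ht (hR i)) (norm_nonneg _)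

/-- On `[a, 1]`, `0 < a`, the terms are bounded by `‖cᵢ‖ a^{-R}` (for `R ≥ 0`). [folklore] -/
theorem norm_term_le_of_mem_Icc (hR : ∀ i, (lam i).re ≤ R) (hR0 : 0 ≤ R) {a t : ℝ} (ha : 0 < a)
    (ht : t ∈ Icc a 1) (i : ι) : ‖c i * (t : ℂ) ^ (-lam i)‖ ≤ ‖c i‖ * a ^ (-R) := by
  refine (norm_term_le hR ⟨ha.trans_le ht.1, ht.2⟩ i).trans ?_
  exact mul_le_mul_of_nonneg_left (Real.rpow_le_rpow_of_nonpos ha ht.1 (by linarith))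
    (norm_nonneg _)

/-- The series defining `F(t)` converges absolutely for `t ∈ (0, 1]`. [folklore] -/
theorem summable_term (hc : Summable fun i ↦ ‖c i‖) (hR : ∀ i, (lam i).re ≤ R) {t : ℝ}
    (ht : t ∈ Ioc (0 : ℝ) 1) : Summable fun i ↦ c i * (t : ℂ) ^ (-lam i) :=
  Summable.of_norm_bounded (hc.mul_right _) (norm_term_le hR ht)

/-- Each term `cᵢ t^{-λᵢ}` is continuous on `(0, ∞)`. [folklore] -/
theorem continuousOn_term (i : ι) :
    ContinuousOn (fun t : ℝ ↦ c i * (t : ℂ) ^ (-lam i)) (Ioi 0) := by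
  refine ContinuousOn.mul continuousOn_const ?_
  refine ContinuousOn.cpow_const (by fun_prop) fun t ht ↦ ?_
  exact Or.inl (by exact_mod_cast (show 0 < t from ht))

/-- `F` is continuous on `[a, 1]` for `0 < a` (uniform convergence). [folklore] -/
theorem continuousOn_powerSum_Icc (hc : Summable fun i ↦ ‖c i‖) (hR : ∀ i, (lam i).re ≤ R)
    (hR0 : 0 ≤ R) {a : ℝ} (ha : 0 < a) : ContinuousOn (powerSum lam c) (Icc a 1) :=
  continuousOn_tsum (fun i ↦ (continuousOn_term i).mono fun _ ht ↦ ha.trans_le ht.1)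
    (hc.mul_right _) fun i _ ht ↦ norm_term_le_of_mem_Icc hR hR0 ha ht i

/-- `F` is continuous on `(0, 1]`. [folklore] -/
theorem continuousOn_powerSum (hc : Summable fun i ↦ ‖c i‖) (hR : ∀ i, (lam i).re ≤ R)
    (hR0 : 0 ≤ R) : ContinuousOn (powerSum lam c) (Ioc 0 1) := by
  intro t₀ ht₀
  have h2 : 0 < t₀ / 2 := by linarith [ht₀.1]
  have hcont := continuousOn_powerSum_Icc hc hR hR0 h2
  have hmem : Icc (t₀ / 2) 1 ∈ 𝓝[Ioc 0 1] t₀ := by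
    refine mem_nhdsWithin.2 ⟨Ioi (t₀ / 2), isOpen_Ioi, by simp only [mem_Ioi]; linarith [ht₀.1],
      fun t ht ↦ ⟨le_of_lt ht.1, ht.2.2⟩⟩
  exact (hcont.continuousWithinAt ⟨by linarith [ht₀.1], ht₀.2⟩).mono_of_mem_nhdsWithin hmem

/-! ### The Mellin transform of the truncated power sum -/

/-- On `(0, 1]` the truncation agrees with `F`. [folklore] -/
theorem mellinInput_of_mem {t : ℝ} (ht : t ∈ Ioc (0 : ℝ) 1) :
    mellinInput lam c t = powerSum lam c t :=
  indicator_of_mem ht _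

/-- The truncation is bounded by `max M 0` everywhere if `F` is bounded by `M` on `(0, 1]`. [folklore] -/
theorem norm_mellinInput_le (hM : ∀ t ∈ Ioc (0 : ℝ) 1, ‖powerSum lam c t‖ ≤ M) (t : ℝ) :
    ‖mellinInput lam c t‖ ≤ max M 0 := by
  unfold mellinInput
  by_cases ht : t ∈ Ioc (0 : ℝ) 1
  · rw [indicator_of_mem ht]
    exact (hM t ht).trans (le_max_left _ _)
  · rw [indicator_of_notMem ht, norm_zero]
    exact le_max_right _ _

/-- The truncated power sum is integrable (bounded, measurable, supported in `(0, 1]`). [folklore] -/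
theorem integrable_mellinInput (hc : Summable fun i ↦ ‖c i‖) (hR : ∀ i, (lam i).re ≤ R)
    (hR0 : 0 ≤ R) (hM : ∀ t ∈ Ioc (0 : ℝ) 1, ‖powerSum lam c t‖ ≤ M) :
    Integrable (mellinInput lam c) := by
  unfold mellinInput
  rw [integrable_indicator_iff measurableSet_Ioc]
  refine ⟨(continuousOn_powerSum hc hR hR0).aestronglyMeasurable measurableSet_Ioc, ?_⟩
  refine HasFiniteIntegral.of_bounded (C := M) ?_
  exact (ae_restrict_iff' measurableSet_Ioc).2 (Eventually.of_forall hM)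

/-- The Mellin transform of the truncated power sum is holomorphic at every `s` with `Re s > 0`
(`mellin_differentiableAt_of_isBigO_rpow`: the input is bounded near `0` and vanishes near `∞`). [folklore] -/
theorem differentiableAt_mellin (hc : Summable fun i ↦ ‖c i‖) (hR : ∀ i, (lam i).re ≤ R)
    (hR0 : 0 ≤ R) (hM : ∀ t ∈ Ioc (0 : ℝ) 1, ‖powerSum lam c t‖ ≤ M) {s : ℂ} (hs : 0 < s.re) :
    DifferentiableAt ℂ (mellin (mellinInput lam c)) s := by
  refine mellin_differentiableAt_of_isBigO_rpow (a := s.re + 1) (b := 0)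
    ((integrable_mellinInput hc hR hR0 hM).locallyIntegrable.locallyIntegrableOn _) ?_ (lt_add_one _)
    ?_ hs
  · -- eventually zero at `∞`
    refine (isBigO_zero (fun t : ℝ ↦ t ^ (-(s.re + 1))) atTop).congr' ?_ EventuallyEq.rfl
    filter_upwards [eventually_gt_atTop 1] with t ht
    exact (indicator_of_notMem (fun h ↦ absurd h.2 (not_le.2 ht)) _).symm
  · -- bounded near `0`
    refine IsBigO.of_bound (max M 0) (Eventually.of_forall fun t ↦ ?_)
    rw [neg_zero, Real.rpow_zero, Real.norm_eq_abs, abs_one, mul_one]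
    exact norm_mellinInput_le hM t

/-- The Mellin transform of the truncated power sum is holomorphic on the half-plane `Re s > 0`. [folklore] -/
theorem differentiableOn_mellin (hc : Summable fun i ↦ ‖c i‖) (hR : ∀ i, (lam i).re ≤ R)
    (hR0 : 0 ≤ R) (hM : ∀ t ∈ Ioc (0 : ℝ) 1, ‖powerSum lam c t‖ ≤ M) :
    DifferentiableOn ℂ (mellin (mellinInput lam c)) {s | 0 < s.re} :=
  fun _ hs ↦ (differentiableAt_mellin hc hR hR0 hM hs).differentiableWithinAt

/-- For `Re s > R` the Mellin transform is the absolutely convergent sum of simple fractions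
`∑ᵢ cᵢ / (s - λᵢ)` (termwise `hasMellin_cpow_Ioc`, interchange by
`hasSum_integral_of_summable_integral_norm` with `∫₀¹ ‖cᵢ t^{s-1-λᵢ}‖ dt ≤ ‖cᵢ‖/(Re s - R)`). [folklore] -/
theorem hasSum_mellin [Countable ι] (hc : Summable fun i ↦ ‖c i‖) (hR : ∀ i, (lam i).re ≤ R)
    {s : ℂ} (hs : R < s.re) :
    HasSum (fun i ↦ c i / (s - lam i)) (mellin (mellinInput lam c) s) := by
  -- each term
  have hterm : ∀ i, HasMellin (indicator (Ioc 0 1) (fun t : ℝ ↦ c i * (t : ℂ) ^ (-lam i))) s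
      (c i / (s - lam i)) := by
    intro i
    have h0 : 0 < s.re + (-lam i).re := by rw [neg_re]; linarith [hR i]
    have h := hasMellin_cpow_Ioc (-lam i) h0
    have h' : (indicator (Ioc 0 1) (fun t : ℝ ↦ c i * (t : ℂ) ^ (-lam i))) =
        fun t ↦ c i • indicator (Ioc 0 1) (fun t : ℝ ↦ (t : ℂ) ^ (-lam i)) t := by
      ext t
      rw [smul_eq_mul, ← indicator_const_mul]
    rw [h']
    refine ⟨h.1.const_smul (c i), ?_⟩
    rw [mellin_const_smul, h.2, smul_eq_mul, ← sub_eq_add_neg, mul_one_div]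
  -- the family of integrands
  set F : ι → ℝ → ℂ := fun i t ↦
    (t : ℂ) ^ (s - 1) • indicator (Ioc 0 1) (fun t : ℝ ↦ c i * (t : ℂ) ^ (-lam i)) t with hF
  have hFint : ∀ i, Integrable (F i) (volume.restrict (Ioi 0)) := fun i ↦ (hterm i).1
  -- norms: `∫ ‖F i‖ ≤ ‖c i‖ / (Re s - R)`
  have hFnorm : ∀ i, ∫ t in Ioi (0 : ℝ), ‖F i t‖ ≤ ‖c i‖ * (1 / (s.re - R)) := by
    intro i
    have hδ : 0 < s.re - R := by linarith
    have hpt : ∀ t ∈ Ioi (0 : ℝ), ‖F i t‖ ≤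
        indicator (Ioc 0 1) (fun t : ℝ ↦ ‖c i‖ * t ^ (s.re - R - 1)) t := by
      intro t ht
      simp only [hF]
      by_cases h1 : t ∈ Ioc (0 : ℝ) 1
      · rw [indicator_of_mem h1, indicator_of_mem h1, smul_eq_mul, norm_mul, norm_mul,
          Complex.norm_cpow_eq_rpow_re_of_pos h1.1, Complex.norm_cpow_eq_rpow_re_of_pos h1.1,
          sub_re, one_re, neg_re]
        calc t ^ (s.re - 1) * (‖c i‖ * t ^ (-(lam i).re))
            = ‖c i‖ * (t ^ (s.re - 1) * t ^ (-(lam i).re)) := by ring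
          _ ≤ ‖c i‖ * (t ^ (s.re - 1) * t ^ (-R)) := by
              refine mul_le_mul_of_nonneg_left (mul_le_mul_of_nonneg_left ?_
                (Real.rpow_nonneg h1.1.le _)) (norm_nonneg _)
              exact Real.rpow_le_rpow_of_exponent_ge h1.1 h1.2 (neg_le_neg (hR i))
          _ = ‖c i‖ * t ^ (s.re - R - 1) := by
              rw [← Real.rpow_add h1.1]; ring_nf
      · rw [indicator_of_notMem h1, indicator_of_notMem h1, smul_zero, norm_zero]
    have hint : IntegrableOn (fun t : ℝ ↦ ‖c i‖ * t ^ (s.re - R - 1)) (Ioc 0 1) := by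
      have h := intervalIntegral.intervalIntegrable_rpow' (a := 0) (b := 1)
        (r := s.re - R - 1) (by linarith)
      rw [intervalIntegrable_iff_integrableOn_Ioc_of_le zero_le_one] at h
      exact h.const_mul _
    calc ∫ t in Ioi (0 : ℝ), ‖F i t‖
        ≤ ∫ t in Ioi (0 : ℝ), indicator (Ioc 0 1) (fun t : ℝ ↦ ‖c i‖ * t ^ (s.re - R - 1)) t := by
          refine setIntegral_mono_on (hFint i).norm ?_ measurableSet_Ioi hpt
          exact (integrable_indicator_iff measurableSet_Ioc).2 hint |>.integrableOn
      _ = ∫ t in Ioc (0 : ℝ) 1, ‖c i‖ * t ^ (s.re - R - 1) := by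
          rw [setIntegral_indicator measurableSet_Ioc, Set.inter_eq_right.2 Ioc_subset_Ioi_self]
      _ = ‖c i‖ * (1 / (s.re - R)) := by
          rw [integral_const_mul, ← intervalIntegral.integral_of_le zero_le_one,
            integral_rpow (Or.inl (by linarith))]
          congr 1
          rw [Real.zero_rpow (by linarith), Real.one_rpow, sub_zero]
          ring_nf
  have hsum : Summable fun i ↦ ∫ t in Ioi (0 : ℝ), ‖F i t‖ :=
    Summable.of_nonneg_of_le (fun i ↦ integral_nonneg fun _ ↦ norm_nonneg _) hFnorm
      (hc.mul_right _)
  have key := hasSum_integral_of_summable_integral_norm hFint hsum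
  have hval : ∀ i, ∫ t in Ioi (0 : ℝ), F i t = c i / (s - lam i) := fun i ↦ (hterm i).2
  simp only [hval] at key
  have hmell : mellin (mellinInput lam c) s = ∫ t in Ioi (0 : ℝ), ∑' i, F i t := by
    rw [mellin]
    refine setIntegral_congr_fun measurableSet_Ioi fun t _ ↦ ?_
    simp only [hF, smul_eq_mul, mellinInput]
    by_cases h1 : t ∈ Ioc (0 : ℝ) 1
    · simp only [indicator_of_mem h1, powerSum]
      exact tsum_mul_left.symm
    · simp only [indicator_of_notMem h1, mul_zero, tsum_zero]
  rw [hmell]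
  exact key

/-! ### Local finiteness bookkeeping -/

/-- A locally finite family of exponents meets every compact set in finitely many indices. [folklore] -/
theorem finite_preimage_of_isCompact (hlf : ∀ z : ℂ, ∃ ε > 0, {i | lam i ∈ ball z ε}.Finite)
    {K : Set ℂ} (hK : IsCompact K) : {i | lam i ∈ K}.Finite := by
  choose ε hε hfin using hlf
  obtain ⟨t, ht⟩ := hK.elim_finite_subcover (fun z : ℂ ↦ ball z (ε z)) (fun _ ↦ isOpen_ball)
    (fun z hz ↦ mem_iUnion.2 ⟨z, mem_ball_self (hε z)⟩)
  refine (t.finite_toSet.biUnion fun z _ ↦ hfin z).subset fun i hi ↦ ?_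
  have h := ht hi
  simp only [mem_iUnion, exists_prop] at h
  simp only [mem_iUnion, mem_setOf_eq, Finset.mem_coe, exists_prop]
  exact h

/-- The set of values of a locally finite family (on any set of indices) is closed. [folklore] -/
theorem isClosed_image (hlf : ∀ z : ℂ, ∃ ε > 0, {i | lam i ∈ ball z ε}.Finite) (S : Set ι) :
    IsClosed (lam '' S) := by
  refine isClosed_of_closure_subset fun z hz ↦ ?_
  obtain ⟨ε, hε, hfin⟩ := hlf z
  have hfin' : (ball z ε ∩ lam '' S).Finite :=
    (hfin.image lam).subset (by rintro w ⟨hw, i, -, rfl⟩; exact ⟨i, hw, rfl⟩)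
  have h : z ∈ closure (ball z ε ∩ lam '' S) :=
    isOpen_ball.inter_closure ⟨mem_ball_self hε, hz⟩
  rw [hfin'.isClosed.closure_eq] at h
  exact h.2

/-! ### The main theorem -/

/-- **Bounded generalized power sums have no modes of positive real part.** Let
`F(t) = ∑ᵢ cᵢ t^{-λᵢ}` with `∑ ‖cᵢ‖ < ∞`, `Re λᵢ ≤ R`, the family `(λᵢ)` locally finite, and
`‖F(t)‖ ≤ M` on `(0, 1]`. Then for every `μ` with `Re μ > 0` the coefficients on the fibre
`{i | λᵢ = μ}` sum to zero. (Proof: the Mellin transform of `F · 1_{(0,1]}` is holomorphic on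
`Re s > 0` and equals `∑ᵢ cᵢ/(s - λᵢ)` for `Re s > R`; clearing the finitely many poles on the
segment `[μ, R + 2 + i Im μ]` and applying the identity theorem on a thin convex neighbourhood of
it shows that the would-be residue at `μ` vanishes.) The fibre is given as a `Finset` `s` with a
membership characterisation, the form in which it is used. [folklore] -/
theorem sum_fiber_eq_zero [Countable ι] (hc : Summable fun i ↦ ‖c i‖)
    (hR : ∀ i, (lam i).re ≤ R) (hlf : ∀ z : ℂ, ∃ ε > 0, {i | lam i ∈ ball z ε}.Finite)
    (hM : ∀ t ∈ Ioc (0 : ℝ) 1, ‖powerSum lam c t‖ ≤ M) {μ : ℂ} (hμ : 0 < μ.re)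
    (s : Finset ι) (hs : ∀ i, i ∈ s ↔ lam i = μ) : ∑ i ∈ s, c i = 0 := by
  classical
  -- trivial if the fibre is empty
  rcases s.eq_empty_or_nonempty with rfl | ⟨i₀, hi₀⟩
  · simp
  have hμi₀ : lam i₀ = μ := (hs i₀).1 hi₀
  have hμR : μ.re ≤ R := hμi₀ ▸ hR i₀
  have hR0 : 0 ≤ R := hμ.le.trans hμR
  -- the segment `K = [μ, R + 2 + i Im μ]`
  set K : Set ℂ := {z | z.re ∈ Icc μ.re (R + 2) ∧ z.im = μ.im} with hK
  have hKc : IsCompact K := by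
    have h : K = Icc μ.re (R + 2) ×ℂ {μ.im} := by
      ext z; simp [hK, Complex.mem_reProdIm]
    rw [h]
    exact isCompact_Icc.reProdIm isCompact_singleton
  have hKconv : Convex ℝ K := by
    have h : K = (Complex.reLm ⁻¹' Icc μ.re (R + 2)) ∩ (Complex.imLm ⁻¹' {μ.im}) := by
      ext z; simp [hK]
    rw [h]
    exact ((convex_Icc _ _).linear_preimage _).inter ((convex_singleton _).linear_preimage _)
  have hμK : μ ∈ K := ⟨⟨le_rfl, by linarith⟩, rfl⟩
  set z₀ : ℂ := ⟨R + 2, μ.im⟩ with hz₀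
  have hz₀K : z₀ ∈ K := ⟨⟨by simp [hz₀]; linarith, by simp [hz₀]⟩, by simp [hz₀]⟩
  have hz₀R : R < z₀.re := by simp [hz₀]
  -- indices with exponent on `K`: a finite set containing the fibre
  set I₀ : Finset ι := (finite_preimage_of_isCompact hlf hKc).toFinset with hI₀
  have hmemI₀ : ∀ i, i ∈ I₀ ↔ lam i ∈ K := fun i ↦ by simp [hI₀]
  have hsI₀ : s ⊆ I₀ := fun i hi ↦ (hmemI₀ i).2 (((hs i).1 hi).symm ▸ hμK)
  have hi₀I₀ : i₀ ∈ I₀ := hsI₀ hi₀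
  -- the other exponents stay away from `K`
  have hT : IsClosed (lam '' ((I₀ : Set ι)ᶜ)) := isClosed_image hlf _
  have hKT : K ⊆ (lam '' ((I₀ : Set ι)ᶜ))ᶜ := by
    rintro z hz ⟨i, hi, rfl⟩
    exact hi ((hmemI₀ i).2 hz)
  obtain ⟨δ₀, hδ₀, hthick⟩ := hKc.exists_thickening_subset_open hT.isOpen_compl hKT
  set δ : ℝ := min δ₀ μ.re with hδdef
  have hδ : 0 < δ := lt_min hδ₀ hμ
  have hδ₀' : δ ≤ δ₀ := min_le_left _ _
  have hδμ : δ ≤ μ.re := min_le_right _ _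
  -- the open convex neighbourhood `N` of `K`
  set N : Set ℂ := thickening (δ / 2) K with hN
  have hNo : IsOpen N := isOpen_thickening
  have hNconv : Convex ℝ N := hKconv.thickening _
  have hKN : K ⊆ N := self_subset_thickening (by positivity) K
  have hNre : ∀ z ∈ N, 0 < z.re := by
    intro z hz
    obtain ⟨k, hk, hzk⟩ := mem_thickening_iff.1 hz
    have h1 : |z.re - k.re| < δ / 2 := by
      calc |z.re - k.re| = |(z - k).re| := by simp
        _ ≤ ‖z - k‖ := Complex.abs_re_le_norm _
        _ = dist z k := (dist_eq_norm z k).symm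
        _ < δ / 2 := hzk
    have h2 : μ.re ≤ k.re := hk.1.1
    rw [abs_lt] at h1
    linarith
  have hNdist : ∀ z ∈ N, ∀ i, i ∉ I₀ → δ / 2 ≤ ‖z - lam i‖ := by
    intro z hz i hi
    obtain ⟨k, hk, hzk⟩ := mem_thickening_iff.1 hz
    have hfar : lam i ∉ thickening δ₀ K := fun h ↦ hthick h ⟨i, hi, rfl⟩
    have h1 : δ₀ ≤ dist (lam i) k := by
      by_contra hlt
      exact hfar (mem_thickening_iff.2 ⟨k, hk, not_le.1 hlt⟩)
    have h2 : dist (lam i) k ≤ dist z (lam i) + dist z k := by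
      rw [dist_comm z (lam i)]; exact dist_triangle _ _ _
    have h3 : dist z (lam i) = ‖z - lam i‖ := dist_eq_norm _ _
    linarith
  -- the tail `G₁` is holomorphic on `N`
  set G₁ : ℂ → ℂ := fun z ↦ ∑' i : ((I₀ : Set ι)ᶜ : Set ι), c i / (z - lam i) with hG₁
  have hG₁d : DifferentiableOn ℂ G₁ N := by
    refine differentiableOn_tsum_of_summable_norm
      (u := fun i : ((I₀ : Set ι)ᶜ : Set ι) ↦ ‖c i‖ * (2 / δ))
      ((hc.subtype _).mul_right _) (fun i ↦ ?_) hNo fun i z hz ↦ ?_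
    · refine DifferentiableOn.div (differentiableOn_const _) (by fun_prop) fun z hz h0 ↦ ?_
      have h := hNdist z hz i i.2
      rw [h0, norm_zero] at h
      linarith
    · rw [norm_div]
      have hzi := hNdist z hz i i.2
      have hpos : 0 < ‖z - lam i‖ := by linarith
      rw [div_le_iff₀ hpos]
      calc ‖c ↑i‖ = ‖c i‖ * (2 / δ) * (δ / 2) := by field_simp
        _ ≤ ‖c i‖ * (2 / δ) * ‖z - lam ↑i‖ := by gcongr
  -- `Φ = mellin - G₁` is holomorphic on `N`
  set Φ : ℂ → ℂ := fun z ↦ mellin (mellinInput lam c) z - G₁ z with hΦ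
  have hΦd : DifferentiableOn ℂ Φ N := by
    refine DifferentiableOn.sub (fun z hz ↦ ?_) hG₁d
    exact (differentiableAt_mellin hc hR hR0 hM (hNre z hz)).differentiableWithinAt
  -- the polynomial `q` clearing the finitely many poles on `K`, and `P = q · (finite part)`
  set V : Finset ℂ := I₀.image lam with hV
  set q : ℂ → ℂ := fun z ↦ ∏ ν ∈ V, (z - ν) with hq
  set P : ℂ → ℂ := fun z ↦ ∑ i ∈ I₀, c i * ∏ ν ∈ V.erase (lam i), (z - ν) with hP
  have hqd : Differentiable ℂ q := by
    simp only [hq]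
    fun_prop
  have hPd : Differentiable ℂ P := by
    simp only [hP]
    fun_prop
  -- on `N ∩ {Re z > R}` we have `q Φ = P`
  have hEq : ∀ z ∈ N, R < z.re → q z * Φ z = P z := by
    intro z hz hzR
    have hne : ∀ i, z - lam i ≠ 0 := fun i h ↦ by
      have h' := congrArg Complex.re h
      simp only [sub_re, zero_re] at h'
      linarith [hR i]
    have h1 : Φ z = ∑ i ∈ I₀, c i / (z - lam i) := by
      simp only [hΦ, hG₁]
      rw [← (hasSum_mellin hc hR hzR).tsum_eq,
        ← (hasSum_mellin hc hR hzR).summable.sum_add_tsum_compl (s := I₀)]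
      ring
    rw [h1, Finset.mul_sum]
    refine Finset.sum_congr rfl fun i hi ↦ ?_
    have hiV : lam i ∈ V := Finset.mem_image_of_mem lam hi
    simp only [hq]
    rw [← Finset.mul_prod_erase V (fun ν ↦ z - ν) hiV, mul_assoc, mul_comm (z - lam i),
      mul_assoc, div_mul_cancel₀ _ (hne i), mul_comm]
  -- identity theorem on the convex open set `N`
  have hEqOn : EqOn (fun z ↦ q z * Φ z) P N := by
    refine ((hqd.differentiableOn.mul hΦd).analyticOnNhd hNo).eqOn_of_preconnected_of_eventuallyEq
      (hPd.differentiableOn.analyticOnNhd hNo) hNconv.isPreconnected (hKN hz₀K) ?_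
    filter_upwards [hNo.mem_nhds (hKN hz₀K),
      (isOpen_lt continuous_const Complex.continuous_re).mem_nhds hz₀R] with z hz hzR
    exact hEq z hz hzR
  -- evaluate at `μ`
  have hμV : μ ∈ V := hμi₀ ▸ Finset.mem_image_of_mem lam hi₀I₀
  have hqμ : q μ = 0 := by
    simp only [hq]
    exact Finset.prod_eq_zero hμV (sub_self μ)
  have hPμ : P μ = 0 := by
    rw [← hEqOn (hKN hμK)]
    simp only [hqμ, zero_mul]
  -- compute `P μ = D · ∑_{i ∈ s} cᵢ` with `D ≠ 0`
  set D : ℂ := ∏ ν ∈ V.erase μ, (μ - ν) with hD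
  have hD0 : D ≠ 0 :=
    Finset.prod_ne_zero_iff.2 fun ν hν ↦ sub_ne_zero.2 (Finset.ne_of_mem_erase hν).symm
  have hPμ' : P μ = D * ∑ i ∈ s, c i := by
    simp only [hP]
    rw [Finset.mul_sum, ← Finset.sum_subset hsI₀]
    · refine Finset.sum_congr rfl fun i hi ↦ ?_
      rw [(hs i).1 hi, mul_comm]
    · intro i hi his
      have hne : lam i ≠ μ := fun h ↦ his ((hs i).2 h)
      have hμVi : μ ∈ V.erase (lam i) := Finset.mem_erase.2 ⟨hne.symm, hμV⟩
      rw [Finset.prod_eq_zero hμVi (sub_self μ), mul_zero]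
  rw [hPμ', mul_eq_zero] at hPμ
  exact hPμ.resolve_left hD0

/-- **Exponential form.** If `F(x) = ∑ᵢ cᵢ e^{λᵢ x}` (with `∑ ‖cᵢ‖ < ∞`, `Re λᵢ ≤ R`, `(λᵢ)`
locally finite) is bounded on `x ≥ 0`, then for every `μ` with `Re μ > 0` the coefficients on the
fibre `{i | λᵢ = μ}` sum to zero (substitute `t = e^{-x}` in `sum_fiber_eq_zero`). [folklore] -/
theorem sum_fiber_eq_zero_of_exp [Countable ι] (hc : Summable fun i ↦ ‖c i‖)
    (hR : ∀ i, (lam i).re ≤ R) (hlf : ∀ z : ℂ, ∃ ε > 0, {i | lam i ∈ ball z ε}.Finite)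
    (hM : ∀ x : ℝ, 0 ≤ x → ‖∑' i, c i * cexp (lam i * x)‖ ≤ M) {μ : ℂ} (hμ : 0 < μ.re)
    (s : Finset ι) (hs : ∀ i, i ∈ s ↔ lam i = μ) : ∑ i ∈ s, c i = 0 := by
  refine sum_fiber_eq_zero hc hR hlf (M := M) (fun t ht ↦ ?_) hμ s hs
  have hx : 0 ≤ -Real.log t := by
    have h := Real.log_nonpos ht.1.le ht.2
    linarith
  have key : powerSum lam c t = ∑' i, c i * cexp (lam i * ((-Real.log t : ℝ) : ℂ)) := by
    unfold powerSum
    congr 1 with i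
    congr 1
    rw [Complex.cpow_def_of_ne_zero (by exact_mod_cast ht.1.ne'), ← Complex.ofReal_log ht.1.le]
    congr 1
    push_cast
    ring
  rw [key]
  exact hM _ hx

/-- **Two-sided exponential form.** If `F(x) = ∑ᵢ cᵢ e^{λᵢ x}` (with `∑ ‖cᵢ‖ < ∞`,
`|Re λᵢ| ≤ R`, `(λᵢ)` locally finite) is bounded on all of `ℝ`, then for every `μ` off the
imaginary axis the coefficients on the fibre `{i | λᵢ = μ}` sum to zero (for `Re μ < 0` apply the
one-sided form to `-λ` and `x ↦ F(-x)`). [folklore] -/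
theorem sum_fiber_eq_zero_of_exp_real [Countable ι] (hc : Summable fun i ↦ ‖c i‖)
    (hR : ∀ i, |(lam i).re| ≤ R) (hlf : ∀ z : ℂ, ∃ ε > 0, {i | lam i ∈ ball z ε}.Finite)
    (hM : ∀ x : ℝ, ‖∑' i, c i * cexp (lam i * x)‖ ≤ M) {μ : ℂ} (hμ : μ.re ≠ 0)
    (s : Finset ι) (hs : ∀ i, i ∈ s ↔ lam i = μ) : ∑ i ∈ s, c i = 0 := by
  rcases hμ.lt_or_gt with hμ | hμ
  · -- `Re μ < 0`: apply the one-sided form to `-λ` and `x ↦ F(-x)`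
    refine sum_fiber_eq_zero_of_exp (lam := fun i ↦ -lam i) (R := R) (M := M) hc
      (fun i ↦ by rw [neg_re]; exact (neg_le_abs _).trans (hR i)) (fun z ↦ ?_) (fun x _ ↦ ?_)
      (μ := -μ) (by rw [neg_re]; linarith) s (fun i ↦ by rw [hs i, neg_inj])
    · obtain ⟨ε, hε, hfin⟩ := hlf (-z)
      refine ⟨ε, hε, hfin.subset fun i hi ↦ ?_⟩
      simp only [mem_setOf_eq, mem_ball, dist_eq_norm] at hi ⊢
      rwa [show -lam i - z = -(lam i - -z) by ring, norm_neg] at hi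
    · have h := hM (-x)
      simpa only [Complex.ofReal_neg, mul_neg, neg_mul] using h
  · exact sum_fiber_eq_zero_of_exp hc (fun i ↦ (le_abs_self _).trans (hR i)) hlf
      (fun x _ ↦ hM x) hμ s hs

end BoundedPowerSum

end Literature.Analysis.Complex

end
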